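import Mathlib
import HarnessLib

/-!
# ζ(5) search — Families: coefficients of products of span polynomials — vanishing iff a Hall condition fails (any span system)

HONEST FRAMING: systematic search; no irrationality claim unless certified.  Cell `pub-zeta5`, certifier 2 (cert-2 g10,
2026-08-22).  Elementary combinatorics of the polynomial `spanProd = ∏_e (Σ_{w ∈ span e} X_w)^{A_e}` for an ARBITRARY finite
span system `span : E → Finset G` (cert-2 g9's `Families/DualRateTables` is the case of the six finite edges of `₈π₈`); nothing
about `ζ(5)`; no conjecture node is used.

* `SpanHall.spanPoly`, `SpanHall.spanProd`;
* **`coeff_spanProd_eq_zero_of_hall_fail`** — if for some set `S` of edges `Σ_{e ∈ S} A_e > Σ_{w ∈ N(S)} B_w` (`N(S)` = the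
  gaps covered by `S`), then `[X^B] spanProd = 0` (every monomial has weight `≥ Σ_S A_e` on `N(S)`);
* **`one_le_coeff_spanProd_of_hall`** — conversely, if every Hall condition holds and `Σ A = Σ B`, then `[X^B] spanProd ≥ 1`:
  Hall's marriage theorem (Mathlib) on the blown-up bipartite graph gives a transport table, i.e. a factorisation of `X^B`
  into admissible monomials of the factors; `coeff_spanProd_nonneg`, **`coeff_spanProd_ne_zero_iff_hall`**.
Used by `Families/CubicalChartVIMLive` for the gap constant terms of Brown's `M_{0,10}` family.  Standard axioms only.
-/

noncomputable section

open Finset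

namespace Summit.KontsevichZagierPeriods.Zeta5Search.Families.Cellular

namespace SpanHall

variable {G E : Type*}

/-- The linear form `Σ_{w ∈ span e} X_w` of an edge. -/
def spanPoly (span : E → Finset G) (e : E) : MvPolynomial G ℤ := ∑ w ∈ span e, MvPolynomial.X w

/-- The span product `∏_e (Σ_{w ∈ span e} X_w)^{A_e}`. -/
def spanProd [Fintype E] (span : E → Finset G) (A : E → ℕ) : MvPolynomial G ℤ := ∏ e, spanPoly span e ^ A e

/-! ## Weights: failing Hall condition ⇒ vanishing coefficient -/

/-- The weight of a monomial on a set of gaps. -/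
def weight (N : Finset G) (m : G →₀ ℕ) : ℕ := ∑ w ∈ N, m w

/-- The weight is additive. -/
theorem weight_add (N : Finset G) (m m' : G →₀ ℕ) : weight N (m + m') = weight N m + weight N m' := by
  simp [weight, Finset.sum_add_distrib]

/-- Lower weight bounds multiply. -/
theorem weight_mul {p q : MvPolynomial G ℤ} {N : Finset G} {a b : ℕ}
    (hp : ∀ m ∈ p.support, a ≤ weight N m) (hq : ∀ m ∈ q.support, b ≤ weight N m) :
    ∀ m ∈ (p * q).support, a + b ≤ weight N m := by
  classical
  intro m hm
  obtain ⟨m₁, hm₁, m₂, hm₂, rfl⟩ := Finset.mem_add.1 (MvPolynomial.support_mul p q hm)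
  rw [weight_add]
  exact Nat.add_le_add (hp m₁ hm₁) (hq m₂ hm₂)

/-- Lower weight bounds for powers. -/
theorem weight_pow {p : MvPolynomial G ℤ} {N : Finset G} {a : ℕ} (hp : ∀ m ∈ p.support, a ≤ weight N m)
    (n : ℕ) : ∀ m ∈ (p ^ n).support, n * a ≤ weight N m := by
  induction n with
  | zero => intro m _; simp
  | succ k ih =>
    intro m hm
    rw [pow_succ] at hm
    have := weight_mul ih hp m hm
    simpa [Nat.succ_mul] using this

/-- The linear form of an edge covered by `N` has weight `≥ 1` on `N`. -/
theorem weight_spanPoly (span : E → Finset G) (e : E) (N : Finset G) (h : span e ⊆ N) :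
    ∀ m ∈ (spanPoly span e).support, 1 ≤ weight N m := by
  classical
  intro m hm
  unfold spanPoly at hm
  obtain ⟨w, hw, hmw⟩ := Finset.mem_biUnion.1 (MvPolynomial.support_sum hm)
  rw [MvPolynomial.support_X, Finset.mem_singleton] at hmw
  subst hmw
  unfold weight
  have : (Finsupp.single w 1 : G →₀ ℕ) w ≤ ∑ x ∈ N, (Finsupp.single w 1 : G →₀ ℕ) x :=
    Finset.single_le_sum (f := fun x => (Finsupp.single w 1 : G →₀ ℕ) x) (fun _ _ => Nat.zero_le _) (h hw)
  simpa using this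

/-- **Failing Hall condition ⇒ the coefficient vanishes**: if `Σ_{e ∈ S} A_e > Σ_{w ∈ N(S)} B_w` then
`[X^B] spanProd = 0`. -/
theorem coeff_spanProd_eq_zero_of_hall_fail [Fintype G] [Fintype E] [DecidableEq G] (span : E → Finset G) (A : E → ℕ) (B : G → ℕ) (S : Finset E)
    (hfail : ∑ w ∈ S.biUnion span, B w < ∑ e ∈ S, A e) :
    MvPolynomial.coeff (Finsupp.equivFunOnFinite.symm B) (spanProd span A) = 0 := by
  classical
  set N := S.biUnion span with hN
  have hfac : ∀ e : E, ∀ m ∈ (spanPoly span e ^ A e).support, (if e ∈ S then A e else 0) ≤ weight N m := by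
    intro e m hm
    split_ifs with he
    · have hsub : span e ⊆ N := Finset.subset_biUnion_of_mem span he
      have := weight_pow (weight_spanPoly span e N hsub) (A e) m hm
      simpa using this
    · exact Nat.zero_le _
  have hprod : ∀ (T : Finset E), ∀ m ∈ (∏ e ∈ T, spanPoly span e ^ A e).support,
      ∑ e ∈ T, (if e ∈ S then A e else 0) ≤ weight N m := by
    intro T
    induction T using Finset.induction_on with
    | empty => intro m hm; simp
    | @insert e T he ih =>
      intro m hm
      rw [Finset.prod_insert he] at hm
      rw [Finset.sum_insert he]
      exact weight_mul (hfac e) ih m hm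
  have hall := hprod Finset.univ
  have hsumS : ∑ e ∈ (Finset.univ : Finset E), (if e ∈ S then A e else 0) = ∑ e ∈ S, A e := by
    rw [← Finset.sum_filter]; congr 1; ext e; simp
  rw [hsumS] at hall
  by_contra hne
  have hmem : Finsupp.equivFunOnFinite.symm B ∈ (spanProd span A).support := MvPolynomial.mem_support_iff.2 hne
  have h1 := hall _ hmem
  have h2 : weight N (Finsupp.equivFunOnFinite.symm B) = ∑ w ∈ N, B w := by simp [weight]
  rw [h2] at h1
  exact absurd (lt_of_lt_of_le hfail h1) (lt_irrefl _)

/-! ## Hall's theorem: all Hall conditions ⇒ positive coefficient -/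

/-- Superadditivity of coefficients for polynomials with non-negative coefficients. -/
theorem coeff_mul_ge {p q : MvPolynomial G ℤ} (hp : ∀ m, 0 ≤ MvPolynomial.coeff m p) (hq : ∀ m, 0 ≤ MvPolynomial.coeff m q)
    (m₁ m₂ : G →₀ ℕ) : MvPolynomial.coeff m₁ p * MvPolynomial.coeff m₂ q ≤ MvPolynomial.coeff (m₁ + m₂) (p * q) := by
  classical
  rw [MvPolynomial.coeff_mul]
  exact Finset.single_le_sum (f := fun x : (G →₀ ℕ) × (G →₀ ℕ) => MvPolynomial.coeff x.1 p * MvPolynomial.coeff x.2 q)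
    (fun x _ => mul_nonneg (hp x.1) (hq x.2)) (a := (m₁, m₂)) (by simp)

/-- Products of polynomials with non-negative coefficients have non-negative coefficients. -/
theorem coeff_mul_nonneg' {p q : MvPolynomial G ℤ} (hp : ∀ m, 0 ≤ MvPolynomial.coeff m p) (hq : ∀ m, 0 ≤ MvPolynomial.coeff m q)
    (m : G →₀ ℕ) : 0 ≤ MvPolynomial.coeff m (p * q) := by
  classical
  rw [MvPolynomial.coeff_mul]
  exact Finset.sum_nonneg fun x _ => mul_nonneg (hp x.1) (hq x.2)

/-- The linear forms have non-negative coefficients. -/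
theorem coeff_spanPoly_nonneg (span : E → Finset G) (e : E) (m : G →₀ ℕ) : 0 ≤ MvPolynomial.coeff m (spanPoly span e) := by
  classical
  unfold spanPoly
  rw [MvPolynomial.coeff_sum]
  exact Finset.sum_nonneg fun w _ => by rw [MvPolynomial.coeff_X]; split_ifs <;> norm_num

/-- Powers of the linear forms have non-negative coefficients. -/
theorem coeff_spanPoly_pow_nonneg (span : E → Finset G) (e : E) (n : ℕ) (m : G →₀ ℕ) :
    0 ≤ MvPolynomial.coeff m (spanPoly span e ^ n) := by
  classical
  induction n generalizing m with
  | zero => rw [pow_zero, MvPolynomial.coeff_one]; split_ifs <;> norm_num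
  | succ k ih => rw [pow_succ]; exact coeff_mul_nonneg' ih (coeff_spanPoly_nonneg span e) m

/-- The span product has non-negative coefficients. -/
theorem coeff_spanProd_nonneg [Fintype E] (span : E → Finset G) (A : E → ℕ) (m : G →₀ ℕ) : 0 ≤ MvPolynomial.coeff m (spanProd span A) := by
  classical
  unfold spanProd
  have : ∀ T : Finset E, ∀ m, 0 ≤ MvPolynomial.coeff m (∏ e ∈ T, spanPoly span e ^ A e) := by
    intro T
    induction T using Finset.induction_on with
    | empty => intro m; rw [Finset.prod_empty, MvPolynomial.coeff_one]; split_ifs <;> norm_num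
    | @insert e T he ih =>
      intro m; rw [Finset.prod_insert he]; exact coeff_mul_nonneg' (coeff_spanPoly_pow_nonneg span e _) ih m
  exact this _ m

/-- A power of a linear form contains every product of its variables. -/
theorem one_le_coeff_spanPoly_pow (span : E → Finset G) (e : E) (n : ℕ) (w : Fin n → G) (hw : ∀ i, w i ∈ span e) :
    1 ≤ MvPolynomial.coeff (∑ i, Finsupp.single (w i) 1) (spanPoly span e ^ n) := by
  classical
  induction n with
  | zero => simp
  | succ k ih =>
    rw [Fin.sum_univ_castSucc, pow_succ]
    have h1 := ih (fun i => w (Fin.castSucc i)) (fun i => hw _)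
    have h2 : MvPolynomial.coeff (Finsupp.single (w (Fin.last k)) 1) (spanPoly span e) = 1 := by
      unfold spanPoly
      rw [MvPolynomial.coeff_sum]
      rw [Finset.sum_eq_single (w (Fin.last k))]
      · simp [MvPolynomial.coeff_X]
      · intro b _ hb; rw [MvPolynomial.coeff_X]; simp [Finsupp.single_eq_single_iff, hb]
      · intro h; exact absurd (hw (Fin.last k)) h
    calc (1 : ℤ) = 1 * 1 := by ring
      _ ≤ MvPolynomial.coeff (∑ i : Fin k, Finsupp.single (w (Fin.castSucc i)) 1) (spanPoly span e ^ k) *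
          MvPolynomial.coeff (Finsupp.single (w (Fin.last k)) 1) (spanPoly span e) := by simp only [h2, mul_one]; exact h1
      _ ≤ _ := coeff_mul_ge (coeff_spanPoly_pow_nonneg span e k) (coeff_spanPoly_nonneg span e) _ _

/-- The blown-up left vertices: `A_e` copies of each edge. -/
abbrev EdgeCopies (A : E → ℕ) : Type _ := Σ e : E, Fin (A e)

/-- The blown-up right vertices: `B_w` copies of each gap. -/
abbrev GapCopies (B : G → ℕ) : Type _ := Σ w : G, Fin (B w)

/-- **All Hall conditions ⇒ positive coefficient.**  If `Σ_{e ∈ S} A_e ≤ Σ_{w ∈ N(S)} B_w` for every set of edges `S`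
and `Σ_e A_e = Σ_w B_w`, then `[X^B] spanProd ≥ 1`. -/
theorem one_le_coeff_spanProd_of_hall [Fintype G] [Fintype E] [DecidableEq G] (span : E → Finset G) (A : E → ℕ) (B : G → ℕ)
    (hHall : ∀ S : Finset E, ∑ e ∈ S, A e ≤ ∑ w ∈ S.biUnion span, B w)
    (hsum : ∑ e, A e = ∑ w, B w) :
    1 ≤ MvPolynomial.coeff (Finsupp.equivFunOnFinite.symm B) (spanProd span A) := by
  classical
  let t : EdgeCopies A → Finset (GapCopies B) := fun x => Finset.univ.filter fun y => y.1 ∈ span x.1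
  have hHall' : ∀ s : Finset (EdgeCopies A), s.card ≤ (s.biUnion t).card := by
    intro s
    set S := s.image Sigma.fst with hS
    have h1 : s.card ≤ ∑ e ∈ S, A e := by
      have hsub : s ⊆ S.sigma fun e => (Finset.univ : Finset (Fin (A e))) := by
        intro x hx
        rw [Finset.mem_sigma]
        exact ⟨Finset.mem_image_of_mem _ hx, Finset.mem_univ _⟩
      calc s.card ≤ (S.sigma fun e => (Finset.univ : Finset (Fin (A e)))).card := Finset.card_le_card hsub
        _ = ∑ e ∈ S, A e := by rw [Finset.card_sigma]; simp
    have h2 : (S.biUnion span).sigma (fun w => (Finset.univ : Finset (Fin (B w)))) ⊆ s.biUnion t := by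
      intro y hy
      rw [Finset.mem_sigma] at hy
      obtain ⟨e, he, hye⟩ := Finset.mem_biUnion.1 hy.1
      obtain ⟨x, hx, rfl⟩ := Finset.mem_image.1 he
      exact Finset.mem_biUnion.2 ⟨x, hx, by simp [t, hye]⟩
    have h3 : ∑ w ∈ S.biUnion span, B w ≤ (s.biUnion t).card := by
      calc ∑ w ∈ S.biUnion span, B w = ((S.biUnion span).sigma fun w => (Finset.univ : Finset (Fin (B w)))).card := by
            rw [Finset.card_sigma]; simp
        _ ≤ (s.biUnion t).card := Finset.card_le_card h2
    exact le_trans h1 (le_trans (hHall S) h3)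
  obtain ⟨f, hf_inj, hf_mem⟩ := (Finset.all_card_le_biUnion_card_iff_exists_injective t).1 hHall'
  have hf_span : ∀ x : EdgeCopies A, (f x).1 ∈ span x.1 := fun x => by
    have := hf_mem x; simpa [t] using this
  have hcard : Fintype.card (EdgeCopies A) = Fintype.card (GapCopies B) := by
    simp only [EdgeCopies, GapCopies, Fintype.card_sigma, Fintype.card_fin]
    exact hsum
  have hf_bij : Function.Bijective f := (Fintype.bijective_iff_injective_and_card f).2 ⟨hf_inj, hcard⟩
  let τ : E → (G →₀ ℕ) := fun e => ∑ i : Fin (A e), Finsupp.single (f ⟨e, i⟩).1 1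
  have hτ : ∀ e, 1 ≤ MvPolynomial.coeff (τ e) (spanPoly span e ^ A e) := fun e =>
    one_le_coeff_spanPoly_pow span e (A e) (fun i => (f ⟨e, i⟩).1) fun i => hf_span ⟨e, i⟩
  have hτsum : ∑ e, τ e = Finsupp.equivFunOnFinite.symm B := by
    have h1 : ∑ e, τ e = ∑ x : EdgeCopies A, Finsupp.single (f x).1 1 := by
      simp only [τ]
      rw [← Finset.univ_sigma_univ, Finset.sum_sigma]
    rw [h1]
    have h2 : ∑ x : EdgeCopies A, Finsupp.single (f x).1 1 = ∑ y : GapCopies B, (Finsupp.single y.1 1 : G →₀ ℕ) :=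
      Fintype.sum_bijective f hf_bij _ _ fun x => rfl
    rw [h2]
    have key : ∀ w : G, (∑ y : GapCopies B, (if y.1 = w then 1 else 0 : ℕ)) = B w := by
      intro w
      rw [Finset.sum_boole]
      have hfil : (Finset.univ.filter fun y : GapCopies B => y.1 = w) =
          ({w} : Finset G).sigma fun v => (Finset.univ : Finset (Fin (B v))) := by
        ext ⟨v, j⟩; simp [Finset.mem_sigma]
      rw [hfil, Finset.card_sigma]
      simp
    ext w
    rw [Finsupp.finsetSum_apply]
    simp only [Finsupp.single_apply, Finsupp.coe_equivFunOnFinite_symm]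
    exact key w
  have hprod : ∀ T : Finset E, (∏ e ∈ T, MvPolynomial.coeff (τ e) (spanPoly span e ^ A e)) ≤
      MvPolynomial.coeff (∑ e ∈ T, τ e) (∏ e ∈ T, spanPoly span e ^ A e) ∧
      ∀ m, 0 ≤ MvPolynomial.coeff m (∏ e ∈ T, spanPoly span e ^ A e) := by
    intro T
    induction T using Finset.induction_on with
    | empty => refine ⟨by simp, fun m => ?_⟩; rw [Finset.prod_empty, MvPolynomial.coeff_one]; split_ifs <;> norm_num
    | @insert e T he ih =>
      rw [Finset.prod_insert he, Finset.prod_insert he, Finset.sum_insert he]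
      refine ⟨?_, fun m => coeff_mul_nonneg' (coeff_spanPoly_pow_nonneg span e _) ih.2 m⟩
      calc MvPolynomial.coeff (τ e) (spanPoly span e ^ A e) * ∏ e ∈ T, MvPolynomial.coeff (τ e) (spanPoly span e ^ A e)
          ≤ MvPolynomial.coeff (τ e) (spanPoly span e ^ A e) * MvPolynomial.coeff (∑ e ∈ T, τ e) (∏ e ∈ T, spanPoly span e ^ A e) :=
            mul_le_mul_of_nonneg_left ih.1 (coeff_spanPoly_pow_nonneg span e _ _)
        _ ≤ _ := coeff_mul_ge (coeff_spanPoly_pow_nonneg span e _) ih.2 _ _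
  have h := (hprod Finset.univ).1
  rw [hτsum] at h
  refine le_trans ?_ h
  have : ∀ e ∈ (Finset.univ : Finset E), 1 ≤ MvPolynomial.coeff (τ e) (spanPoly span e ^ A e) := fun e _ => hτ e
  calc (1 : ℤ) = ∏ e ∈ (Finset.univ : Finset E), (1 : ℤ) := by simp
    _ ≤ _ := Finset.prod_le_prod (fun _ _ => zero_le_one) this

/-- **The coefficient is non-zero iff all Hall conditions hold** (given `Σ A = Σ B`). -/
theorem coeff_spanProd_ne_zero_iff_hall [Fintype G] [Fintype E] [DecidableEq G] (span : E → Finset G) (A : E → ℕ) (B : G → ℕ)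
    (hsum : ∑ e, A e = ∑ w, B w) :
    MvPolynomial.coeff (Finsupp.equivFunOnFinite.symm B) (spanProd span A) ≠ 0 ↔
      ∀ S : Finset E, ∑ e ∈ S, A e ≤ ∑ w ∈ S.biUnion span, B w := by
  constructor
  · intro h S
    by_contra hS
    exact h (coeff_spanProd_eq_zero_of_hall_fail span A B S (by omega))
  · intro hHall
    have := one_le_coeff_spanProd_of_hall span A B hHall hsum
    omega

end SpanHall

end Summit.KontsevichZagierPeriods.Zeta5Search.Families.Cellular
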